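import Summits.CriticalPhenomena.PercolationContinuityZ3.Theorems.FK.ClusterDensityContinuity
import Summits.CriticalPhenomena.PercolationContinuityZ3.Theorems.FK.InfiniteVolumeMonotone
import Summits.CriticalPhenomena.PercolationContinuityZ3.Theorems.FK.InfiniteVolumeMeasures
import Summits.CriticalPhenomena.PercolationContinuityZ3.Theorems.FK.InfiniteVolumeBoxLaws
import Summits.CriticalPhenomena.PercolationContinuityZ3.Theorems.FK.InfiniteVolumeDLRRegionTransport
import Summits.CriticalPhenomena.PercolationContinuityZ3.Theorems.FK.FreeEdwardsSokalTwoPoint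
import Summits.CriticalPhenomena.PercolationContinuityZ3.Theorems.FK.DomainMarkovExtremality
import Summits.CriticalPhenomena.PercolationContinuityZ3.Theorems.FK.ClusterCountInverse
import Literature.Probability.LatticeModels.RandomClusterFiniteVolumePressure
import HarnessLib

/-!
# FK-continuity cell, FO-10a: the FREE box law has at least `|Λ_N| κ⁰ − 1` clusters on average —
# `Σ_{x ∈ Λ_N} φ⁰_{p,q}(|C_x|⁻¹) − 1 ≤ φ⁰_{Λ_N,p,q}(k(ω,Λ_N))` (Grimmett 2006, proof of Thm. (4.58), (4.81)–(4.83), free side)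

Registered R89 (cell INBOX l.6394, 2026-08-24); registry row FO-10a-g338k; label KAP-C (coordinator fk-4 g195).
Cell `fk-continuity` (bschramm), row FO-10a; support file for the FK-continuity transplant
(`--supports stmt-CriticalPhenomena-4575`); builds on p205010 (kernel theorem, internal audit signed;
external expert review pending). Pure proofs; no definitions, no named facts, no sorries; general `d`.

The free lower bound of the mean number of open clusters of the box law, WITHOUT the ergodic theorem (4.83):
`k(ω,Λ) = Σ_{x∈Λ} |C^Λ_x|⁻¹` (`ClusterCountInverse.lean`), `|C^Λ_x|⁻¹ = 1 − Σ_{k=2}^{|Λ|} 1{|C^Λ_x| ≥ k}/((k−1)k)`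
(`ClusterSizeLocality.lean`), the events `{|C_x| ≥ k}` have increasing LOCAL proxies (`ClusterDensityContinuity.lean`)
on which `φ⁰_Λ ≤ φ⁰` (`rcBoxLaw_real_le_rcLimit`), and `φ⁰(|C_x|⁻¹) ≤ 1 − Σ_{k=2}^{|Λ|} φ⁰(|C_x| ≥ k)/((k−1)k) + 1/|Λ|`
(`abs_integral_inv_ncard_sub_le`).

* `mem_of_reachable_liftEdges`, `openCluster_liftEdges_eq_image`, `ncard_openCluster_liftEdges` — the open cluster of
  `x ∈ Λ` in the lifted configuration is the image of its cluster in the piece `Λ`;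
* `rcExpect_inv_ncard_openCluster_ge` — per site: `φ⁰_{p,q}(|C_x|⁻¹) − 1/|Λ_N| ≤ E⁰_{Λ_N,p,q}[|C^{Λ_N}_x|⁻¹]`;
* HEADLINE `sum_integral_inv_ncard_sub_one_le_rcExpect_clusterCount` —
  `Σ_{x ∈ Λ_N} ∫ |C_x|⁻¹ dφ⁰_{p,q} − 1 ≤ E⁰_{Λ_N,p,q}[k(ω, Λ_N)]`.

## References
* G. Grimmett, *The Random-Cluster Model*, Springer 2006 (`book:grimmett2006-random-cluster-model`): §4.5,
  proof of Thm. (4.58), (4.81)–(4.83) [PDF p. 94]. [Grimmett2006]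
-/

noncomputable section

open scoped Classical
open Finset Filter Topology MeasureTheory

namespace Summit.CriticalPhenomena.PercolationContinuityZ3.Theorems.FK

open Literature.Probability.Percolation Literature.Probability.LatticeModels

variable {d : ℕ}

/-! ### Clusters of a lifted configuration -/

section Lift

/-- An open edge of a lifted configuration has both endpoints in the piece. [folklore] -/
theorem mem_of_adj_liftEdges {Λ : Finset (Site d)} {ω : BondConfig ↥Λ} {a b : Site d}
    (h : (openGraph (liftEdges Λ ω)).Adj a b) : b ∈ Λ := by
  rw [openGraph_adj] at h
  obtain ⟨⟨e', -, hee'⟩, -⟩ := h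
  induction e' using Sym2.ind with
  | h a' b' =>
    rw [Sym2.map_mk, Sym2.eq_iff] at hee'
    rcases hee' with ⟨-, h2⟩ | ⟨h1, -⟩
    · exact h2 ▸ b'.2
    · exact h1 ▸ a'.2

/-- Open paths of a lifted configuration stay in the piece. [folklore] -/
theorem mem_of_reachable_liftEdges {Λ : Finset (Site d)} {ω : BondConfig ↥Λ} {u v : Site d}
    (h : (openGraph (liftEdges Λ ω)).Reachable u v) (hu : u ∈ Λ) : v ∈ Λ := by
  obtain ⟨W⟩ := h
  induction W with
  | nil => exact hu
  | cons hadj _ ih => exact ih (mem_of_adj_liftEdges hadj)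

/-- **The open cluster of `x ∈ Λ` in the lifted configuration is the image of its cluster in the piece.** [folklore] -/
theorem openCluster_liftEdges_eq_image {Λ : Finset (Site d)} (ω : BondConfig ↥Λ) (x : ↥Λ) :
    openCluster (liftEdges Λ ω) (x : Site d) = Subtype.val '' openCluster ω x := by
  ext y
  constructor
  · intro hy
    have hyΛ : y ∈ Λ := mem_of_reachable_liftEdges hy x.2
    have h : liftEdges Λ ω ∈ openConn (x : Site d) y := hy
    rw [← Set.mem_preimage, liftEdges_preimage_openConn Λ x.2 hyΛ] at h
    exact ⟨⟨y, hyΛ⟩, h, rfl⟩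
  · rintro ⟨y', hy', rfl⟩
    have h : ω ∈ openConn x y' := hy'
    rw [← liftEdges_preimage_openConn Λ x.2 y'.2, Set.mem_preimage] at h
    exact h

/-- Hence the cluster sizes agree (`encard`). [folklore] -/
theorem encard_openCluster_liftEdges {Λ : Finset (Site d)} (ω : BondConfig ↥Λ) (x : ↥Λ) :
    (openCluster (liftEdges Λ ω) (x : Site d)).encard = (openCluster ω x).encard := by
  rw [openCluster_liftEdges_eq_image, Subtype.val_injective.encard_image]

/-- Hence the cluster sizes agree (`ncard`). [folklore] -/
theorem ncard_openCluster_liftEdges {Λ : Finset (Site d)} (ω : BondConfig ↥Λ) (x : ↥Λ) :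
    (openCluster (liftEdges Λ ω) (x : Site d)).ncard = (openCluster ω x).ncard := by
  rw [openCluster_liftEdges_eq_image, Set.ncard_image_of_injective _ Subtype.val_injective]

/-- A lifted edge configuration of the box graph lies inside `E_{Λ_N} ⊆ E_{Λ_{N+k}}`. [folklore] -/
theorem liftEdges_coe_subset_edgesIn {N : ℕ} {ω : Finset (Sym2 ↥(box d N))}
    (hω : ω ⊆ (finsetGraph (zdGraph d) (box d N)).edgeFinset) (k : ℕ) :
    liftEdges (box d N) (↑ω : BondConfig ↥(box d N)) ⊆ ↑(edgesIn (zdGraph d) (box d (N + k))) := by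
  rintro e ⟨e', he', rfl⟩
  have h : Sym2.map Subtype.val e' ∈ (finsetGraph (zdGraph d) (box d N)).edgeFinset.image (Sym2.map Subtype.val) :=
    Finset.mem_image_of_mem _ (hω he')
  rw [image_edgeFinset_finsetGraph_eq_edgesIn] at h
  exact edgesIn_mono (zdGraph d) (box_mono d (Nat.le_add_right N k)) h

end Lift

/-! ### Per site: `φ⁰_{Λ_N}(|C^{Λ_N}_x| ≥ k) ≤ φ⁰(|C_x| ≥ k)` and `φ⁰(|C_x|⁻¹) − 1/|Λ_N| ≤ E⁰_{Λ_N}[|C^{Λ_N}_x|⁻¹]` -/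

section PerSite

variable {p q : ℝ}

/-- **`φ⁰_{Λ_N,p,q}(|C^{Λ_N}_x| ≥ k) ≤ φ⁰_{p,q}(|C_x| ≥ k)`** for `x ∈ Λ_N`: the free box law is dominated by the free limit
on the increasing LOCAL proxy of `{|C_x| ≥ k}` (`rcBoxLaw_real_le_rcLimit`), and both measures see the proxy as
`{|C_x| ≥ k}` (the box law through the lift, the limit being lattice-carried).
[cite: Grimmett2006, Thm. (4.19)(b) proof with (4.81)] -/
theorem rcBoxMeasure_real_clusterSizeGe_le (hp : p ∈ Set.Icc (0 : ℝ) 1) (hq : 1 ≤ q) {N : ℕ}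
    (x : ↥(box d N)) (k : ℕ) :
    (rcBoxMeasure d false p q N).real (clusterSizeGe x k) ≤ (rcLimit d false p q).real (clusterSizeGe (x : Site d) k) := by
  have hq0 : 0 < q := one_pos.trans_le hq
  set A : Set (BondConfig (Site d)) :=
    {ω | (k : ℕ∞) ≤ (openCluster (ω ∩ ↑(edgesIn (zdGraph d) (box d (N + k)))) (x : Site d)).encard} with hA
  have hAdet := determinedBy_le_encard_openCluster_inter (x : Site d) N k
  have hAup := isUpperSet_le_encard_openCluster_inter (x : Site d) N k
  -- the box side: `clusterSizeGe x k` and `liftEdges ⁻¹' A` agree on configurations of the box graph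
  have hbox : (rcBoxMeasure d false p q N).real (clusterSizeGe x k) =
      (rcBoxMeasure d false p q N).real (liftEdges (box d N) ⁻¹' A) := by
    rw [rcBoxMeasure, rcMeasure_real_eq_rcExpect _ hp hq0, rcMeasure_real_eq_rcExpect _ hp hq0]
    refine rcExpect_congr _ p q _ fun ω hω => ?_
    have hint : liftEdges (box d N) (↑ω : BondConfig ↥(box d N)) ∩ ↑(edgesIn (zdGraph d) (box d (N + k))) =
        liftEdges (box d N) (↑ω : BondConfig ↥(box d N)) :=
      Set.inter_eq_left.2 (liftEdges_coe_subset_edgesIn hω k)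
    have key : ((↑ω : BondConfig ↥(box d N)) ∈ clusterSizeGe x k) ↔
        liftEdges (box d N) (↑ω : BondConfig ↥(box d N)) ∈ A := by
      rw [hA, Set.mem_setOf_eq, hint, encard_openCluster_liftEdges, mem_clusterSizeGe]
    simp only [Set.mem_preimage, key]
  rw [hbox, ← rcBoxLaw_real_apply false p q N (hAdet.measurableSet_of_finset),
    measureReal_clusterSizeGe_eq_of_ae_subset ((isBoxLimit_rcLimit false hp hq).ae_subset_edgeSet hp hq0) x.2 k]
  exact rcBoxLaw_real_le_rcLimit hp hq ⟨_, hAdet⟩ hAup N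

/-- On the box graph, `|C^{Λ_N}_x(ω)|⁻¹ = 1 − Σ_{k=2}^{|Λ_N|} 1{|C^{Λ_N}_x(ω)| ≥ k}/((k−1)k)` (the truncation at `|Λ_N|`
is exact). [cite: Grimmett2006, proof of Thm. (4.58), display after (4.82)] -/
theorem inv_ncard_openCluster_eq_one_sub_sum {N : ℕ} (ω : BondConfig ↥(box d N)) (x : ↥(box d N)) :
    ((openCluster ω x).ncard : ℝ)⁻¹ =
      1 - ∑ k ∈ Finset.Icc 2 (Fintype.card ↥(box d N)),
        (if ω ∈ clusterSizeGe x k then (1 : ℝ) / (((k : ℝ) - 1) * k) else 0) := by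
  have hM1 : 1 ≤ Fintype.card ↥(box d N) := Fintype.card_pos_iff.2 ⟨x⟩
  have hle : (openCluster ω x).ncard ≤ Fintype.card ↥(box d N) := by
    rw [← Nat.card_eq_fintype_card, ← Set.ncard_univ]
    exact Set.ncard_le_ncard (Set.subset_univ _)
  have hfin : (openCluster ω x).Finite := Set.toFinite _
  generalize Fintype.card ↥(box d N) = M at hM1 hle ⊢
  rw [sum_Icc_indicator_clusterSizeGe_eq x ω M hM1, sub_sub_cancel, one_div, if_pos hfin, min_eq_right hle]

/-- **Per site: `φ⁰_{p,q}(|C_x|⁻¹) − 1/|Λ_N| ≤ E⁰_{Λ_N,p,q}[|C^{Λ_N}_x|⁻¹]`** (`x ∈ Λ_N`).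
[cite: Grimmett2006, proof of Thm. (4.58), (4.81)–(4.83)] -/
theorem integral_inv_ncard_sub_le_rcExpect (hp : p ∈ Set.Icc (0 : ℝ) 1) (hq : 1 ≤ q) {N : ℕ} (x : ↥(box d N)) :
    ∫ ω, ((openCluster ω (x : Site d)).ncard : ℝ)⁻¹ ∂(rcLimit d false p q) - 1 / Fintype.card ↥(box d N) ≤
      rcExpect (finsetGraph (zdGraph d) (box d N)) p q (boxBC d false N)
        (fun ω => (((openCluster (↑ω : BondConfig ↥(box d N)) x).ncard : ℝ))⁻¹) := by
  have hq0 : 0 < q := one_pos.trans_le hq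
  haveI := isProbabilityMeasure_rcLimit (d := d) false p q
  set M := Fintype.card ↥(box d N) with hM
  have hM1 : 1 ≤ M := Fintype.card_pos_iff.2 ⟨x⟩
  -- the infinite-volume side: `|κ⁰(x) − (1 − Σ φ⁰(|C_x| ≥ k)/((k−1)k))| ≤ 1/M`
  have hlim := abs_integral_inv_ncard_sub_le (rcLimit d false p q) (x : Site d) M hM1
  have h1 : ∫ ω, ((openCluster ω (x : Site d)).ncard : ℝ)⁻¹ ∂(rcLimit d false p q) - 1 / M ≤
      1 - ∑ k ∈ Finset.Icc 2 M, (rcLimit d false p q).real (clusterSizeGe (x : Site d) k) / (((k : ℝ) - 1) * k) := by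
    have := (abs_le.1 hlim).2
    linarith
  -- the box side: `E⁰_Λ[|C^Λ_x|⁻¹] = 1 − Σ φ⁰_Λ(|C^Λ_x| ≥ k)/((k−1)k)`
  have h2 : rcExpect (finsetGraph (zdGraph d) (box d N)) p q (boxBC d false N)
        (fun ω => (((openCluster (↑ω : BondConfig ↥(box d N)) x).ncard : ℝ))⁻¹) =
      1 - ∑ k ∈ Finset.Icc 2 M, (rcBoxMeasure d false p q N).real (clusterSizeGe x k) / (((k : ℝ) - 1) * k) := by
    have hfun : (fun ω : Finset (Sym2 ↥(box d N)) => (((openCluster (↑ω : BondConfig ↥(box d N)) x).ncard : ℝ))⁻¹) =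
        fun ω : Finset (Sym2 ↥(box d N)) => (1 : ℝ) - ∑ k ∈ Finset.Icc 2 M,
          (1 / (((k : ℝ) - 1) * k)) * (if (↑ω : BondConfig ↥(box d N)) ∈ clusterSizeGe x k then (1 : ℝ) else 0) := by
      funext ω
      rw [inv_ncard_openCluster_eq_one_sub_sum, ← hM]
      refine congrArg (fun t : ℝ => (1 : ℝ) - t) (Finset.sum_congr rfl fun k _ => ?_)
      split_ifs <;> simp
    rw [hfun, rcExpect_sub, rcExpect_const _ hp hq0, rcExpect_finset_sum]
    refine congrArg (fun t : ℝ => (1 : ℝ) - t) (Finset.sum_congr rfl fun k _ => ?_)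
    rw [rcExpect_const_mul, rcBoxMeasure, rcMeasure_real_eq_rcExpect _ hp hq0]
    ring
  rw [h2]
  refine h1.trans ?_
  -- termwise comparison
  have hsum : ∑ k ∈ Finset.Icc 2 M, (rcBoxMeasure d false p q N).real (clusterSizeGe x k) / (((k : ℝ) - 1) * k) ≤
      ∑ k ∈ Finset.Icc 2 M, (rcLimit d false p q).real (clusterSizeGe (x : Site d) k) / (((k : ℝ) - 1) * k) := by
    refine Finset.sum_le_sum fun k hk => ?_
    have hk2 : (2 : ℝ) ≤ k := by exact_mod_cast (Finset.mem_Icc.1 hk).1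
    exact div_le_div_of_nonneg_right (rcBoxMeasure_real_clusterSizeGe_le hp hq x k) (by nlinarith)
  linarith

end PerSite

/-! ### The sum over the box -/

section Sum

variable {p q : ℝ}

/-- **`Σ_{x ∈ Λ_N} φ⁰_{p,q}(|C_x|⁻¹) − 1 ≤ E⁰_{Λ_N,p,q}[k(ω,Λ_N)]`**: the mean number of open clusters of the free box
law is at least the sum of the infinite-volume free cluster densities over the box, minus one.
[cite: Grimmett2006, proof of Thm. (4.58), (4.81)–(4.83) (free side, without the ergodic theorem)] -/
theorem sum_integral_inv_ncard_sub_one_le_rcExpect_clusterCount (hp : p ∈ Set.Icc (0 : ℝ) 1) (hq : 1 ≤ q) (N : ℕ) :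
    ∑ x : ↥(box d N), ∫ ω, ((openCluster ω (x : Site d)).ncard : ℝ)⁻¹ ∂(rcLimit d false p q) - 1 ≤
      rcExpect (finsetGraph (zdGraph d) (box d N)) p q (boxBC d false N)
        (fun ω => (clusterCount (↑ω : BondConfig ↥(box d N)) (boxBC d false N) : ℝ)) := by
  set M := Fintype.card ↥(box d N) with hM
  have hM0 : (0 : ℝ) < M := by
    have : 0 < M := Fintype.card_pos_iff.2 ⟨⟨0, zero_mem_box d N⟩⟩
    exact_mod_cast this
  have hfree : boxBC d false N = (∅ : Set ↥(box d N)) := rfl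
  have hk : (fun ω : Finset (Sym2 ↥(box d N)) => (clusterCount (↑ω : BondConfig ↥(box d N)) (boxBC d false N) : ℝ)) =
      fun ω : Finset (Sym2 ↥(box d N)) => ∑ x : ↥(box d N), (((openCluster (↑ω : BondConfig ↥(box d N)) x).ncard : ℝ))⁻¹ := by
    funext ω
    rw [hfree, clusterCount_empty_eq_sum_inv_ncard_openCluster]
  rw [hk, rcExpect_finset_sum]
  have h := Finset.sum_le_sum fun x (_ : x ∈ (Finset.univ : Finset ↥(box d N))) =>
    integral_inv_ncard_sub_le_rcExpect hp hq x
  rw [Finset.sum_sub_distrib, Finset.sum_const, Finset.card_univ, nsmul_eq_mul, ← hM,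
    mul_one_div, div_self hM0.ne'] at h
  exact h

end Sum

end Summit.CriticalPhenomena.PercolationContinuityZ3.Theorems.FK

end
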